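import Summits.Ventures.YMGap.RobustBall.PlaquetteFirstMoment
import Summits.Ventures.YMGap.RobustBall.WilsonStringTension
import HarnessLib

/-!
# Robust ball (Y2), area-law side — the plaquette of every limit state carries the EXACT LEADING COEFFICIENT (abstract `G ≅ SU(N)`)

HONEST FRAMING: venture file of the cell `pub-ymgap` (QuantumFields programme), track ROBUST-BALL, seat rb-p2 (g6); file 1 of 2 (abstract part; the `SU(N)` /
`SU(2)` / `SU(3)` cells are in `StringTensionCeilingLinear`).  LATTICE
statements about the infinite-volume limit states (`infiniteVolumeLimitPoints`) of the `SU(N)` torus Wilson states at tree coupling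
`β` (`= β_W/N`); `σ(μ) = stringTension μ χ_N` exists at every `β > 0` for the Wilson member (`WilsonStringTension.stringTension_le`,
reflection positivity).  WHAT IS NEW.  The plaquette floor of rb-p2 g3/g5, `W_μ(1,1) ≥ u · e^{−8nNβ}/(2n)` (`u = βV₀/N`,
dimension `n + 1`), lost the factor `1/(2n)` = «the plaquette floor shares `∑_{p ∋ e}` over the `2n` plaquettes through a link»,
i.e. an additive `log(2n)` on the ceiling side of the strong-coupling law.  The per-link first moment of `PlaquetteFirstMoment`
(sequential resampling of one private link per plaquette) removes it:
* every `G ≅ SU(N)`, `N ≥ 2`, `d = n + 1 ≥ 2`, every `β > 0`, every limit state (`rectExpectation_one_one_ge_sum/_linear`):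
  `W_μ(1,1) ≥ u · e^{−D} · (1/2n) ∑_{k=1}^{2n} e^{−kD} ≥ u · e^{−2n(2n+3)Nβ}`, `D = 4nNβ`, with `u = βV₀/N` THE EXACT LEADING
  COEFFICIENT of the strong-coupling series (`β_W/4` for `SU(2)`, `β_W/(2N²)` for `N ≥ 3`; `V₀` from `HaarSecondMoments`);
* hence the CEILING `σ(μ) ≤ −log W_μ(1,1) ≤ log(1/u) + 2n(2n+3)Nβ` with NO additive constant (`stringTension_le_log_linear_of_model`):
  ★★ `SU(2)`: `σ(μ) ≤ log(4/β_W) + 2n(2n+3)β_W` at EVERY `β_W > 0` (`d = 4`: `log(4/β_W) + 54β_W`; `d = 3`: `+ 28β_W`);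
  every `N ≥ 2`: `σ(μ) ≤ log(2N/β) + 2n(2n+3)Nβ`; `SU(3)`, `d = 4`: `σ(μ) ≤ log(18/β_W) + 54β_W`;
* ★★ the `SU(2)`, `d = 4` law becomes `log(4/β_W) − log 6 ≤ σ(μ) ≤ log(4/β_W) + 54β_W` on `0 < β_W ≤ 2/3`
  (`su2_stringTension_two_sided_linear_dim4`): the deviation above Wilson's leading term is `O(β_W)` — as `β_W → 0` the ceiling-side
  loss VANISHES (`su2_stringTension_ceiling_limit_dim4`: `∀ ε > 0 ∃ β₀ > 0 ∀ β_W ≤ β₀ ∀ μ, σ(μ) ≤ log(4/β_W) + ε`), the remaining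
  `log 6 = log(2n)` below is the Dobrushin door's alone; joined with g5: `σ(μ) − log(4/β_W) ≤ min(log 6 + 24β_W, 54β_W)`;
* the static quark potential: `V_μ(R) ≤ (log(4/β_W) + 2n(2n+3)β_W)·R` (`SU(2)`), two-sided at `d = 4`.
WHAT IT IS NOT: the `β`-coefficients are one-link artefacts (the series' `O(β_W²)` is not claimed); `σ`-existence is the Wilson
member's; nothing continuum / spectral / Clay.  0 compute.

References: K. Wilson, Phys. Rev. D 10 (1974) 2445; E. Seiler, LNP 159 (1982) §2; M. Creutz, *Quarks, gluons and lattices* (1983)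
§8–§10 (for comparison only).  Everything here is proved. [folklore]
-/

noncomputable section

open MeasureTheory Filter Topology Finset
open Literature.MathematicalPhysics.QuantumLattice
open Literature.MathematicalPhysics.QuantumFieldTheory hiding ZdEdge Site

namespace Summit.Ventures.YMGap.RobustBall

namespace StringTensionExplicit

/-! ### An elementary inequality: the mean of `e^{−D}, …, e^{−mD}` is at least `e^{−(m+1)D/2}` -/

/-- **`∑_{k=1}^{m} e^{−kD} ≥ m · e^{−(m+1)D/2}`** (pair `k` with `m + 1 − k` and use AM–GM `e^x + e^y ≥ 2e^{(x+y)/2}`).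
[folklore] -/
theorem card_mul_exp_le_sum_exp (m : ℕ) (D : ℝ) :
    (m : ℝ) * Real.exp (-(((m : ℝ) + 1) / 2 * D)) ≤ ∑ k ∈ Finset.range m, Real.exp (-(((k : ℝ) + 1) * D)) := by
  -- AM–GM for two exponentials (inlined)
  have amgm : ∀ x y : ℝ, 2 * Real.exp ((x + y) / 2) ≤ Real.exp x + Real.exp y := by
    intro x y
    have hx : Real.exp x = Real.exp (x / 2) ^ 2 := by rw [sq, ← Real.exp_add]; ring_nf
    have hy : Real.exp y = Real.exp (y / 2) ^ 2 := by rw [sq, ← Real.exp_add]; ring_nf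
    have hm : Real.exp ((x + y) / 2) = Real.exp (x / 2) * Real.exp (y / 2) := by rw [← Real.exp_add]; ring_nf
    rw [hx, hy, hm]
    nlinarith [sq_nonneg (Real.exp (x / 2) - Real.exp (y / 2))]
  set f : ℕ → ℝ := fun k => Real.exp (-(((k : ℝ) + 1) * D)) with hf
  have hrefl : ∑ k ∈ Finset.range m, f (m - 1 - k) = ∑ k ∈ Finset.range m, f k := Finset.sum_range_reflect f m
  have hpair : ∀ k ∈ Finset.range m, 2 * Real.exp (-(((m : ℝ) + 1) / 2 * D)) ≤ f k + f (m - 1 - k) := by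
    intro k hk
    have hkm : k < m := Finset.mem_range.1 hk
    have hcast : (((m - 1 - k : ℕ) : ℝ) + 1) = (m : ℝ) - k := by
      rw [Nat.sub_sub, Nat.cast_sub (by omega)]; push_cast; ring
    have h := amgm (-(((k : ℝ) + 1) * D)) (-((((m - 1 - k : ℕ) : ℝ) + 1) * D))
    rw [hcast] at h
    have e : (-(((k : ℝ) + 1) * D) + -(((m : ℝ) - k) * D)) / 2 = -(((m : ℝ) + 1) / 2 * D) := by ring
    rw [e] at h
    rw [hf]
    simp only
    rw [hcast]
    exact h
  have h2 : 2 * ((m : ℝ) * Real.exp (-(((m : ℝ) + 1) / 2 * D))) ≤ 2 * ∑ k ∈ Finset.range m, f k := by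
    calc 2 * ((m : ℝ) * Real.exp (-(((m : ℝ) + 1) / 2 * D)))
        = ∑ _k ∈ Finset.range m, 2 * Real.exp (-(((m : ℝ) + 1) / 2 * D)) := by
          rw [Finset.sum_const, Finset.card_range, nsmul_eq_mul]; ring
      _ ≤ ∑ k ∈ Finset.range m, (f k + f (m - 1 - k)) := Finset.sum_le_sum hpair
      _ = 2 * ∑ k ∈ Finset.range m, f k := by rw [Finset.sum_add_distrib, hrefl]; ring
  linarith

/-! ### Every compact `G ≅ SU(N)`: the plaquette of a limit state carries the exact leading coefficient -/

section Model

variable {d N : ℕ} [NeZero d] {G : Type*} [Group G] [TopologicalSpace G] [IsTopologicalGroup G]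
  [CompactSpace G] [MeasurableSpace G] [BorelSpace G] [SecondCountableTopology G] [T2Space G]
  (ρ : G →* Matrix (Fin N) (Fin N) ℂ)

/-- **The plaquette of a limit state, without the `1/(2(d−1))` loss**: for `G ≅ SU(N)`, `N ≥ 2`, `d ≥ 2`, every `β ≥ 0` and every
infinite-volume limit point `μ` of the torus Wilson states,
`∫ Re tr ρ(U_p) dμ ≥ β e^{−D} V₀ (∑_{k=1}^{2(d−1)} e^{−kD}) / (2(d−1))`, `D = 4(d−1)Nβ`, for the plaquette at the origin of the
`(0,1)` plane (`PlaquetteFirstMoment.integral_sum_plaquetteObs_ge_sum` at the link `(0,0)`, distributed over the `2(d−1)` plaquettes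
through it by translation and axis-permutation invariance, `PlaquettePositivity.integral_plaquetteObs_eq`). [folklore] -/
theorem integral_plaquetteObs_ge_sum (hρ : IsSpecialUnitaryModel ρ) (hN : 2 ≤ N) (hd : 2 ≤ d) {β : ℝ} (hβ : 0 ≤ β)
    {μ : Measure (LGConfig d G)} (hμ : μ ∈ infiniteVolumeLimitPoints ρ β) :
    β * Real.exp (-(4 * ((d : ℝ) - 1) * N * β)) * PlaquetteLowerBound.charVariance ρ *
        (∑ k ∈ Finset.range (2 * (d - 1)), Real.exp (-(((k : ℝ) + 1) * (4 * ((d : ℝ) - 1) * N * β)))) /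
          (2 * ((d : ℝ) - 1)) ≤
      ∫ U, plaquetteObs ρ 0 0 1 U ∂μ := by
  have hG : μ ∈ ymGibbsMeasures ρ β := mem_ymGibbsMeasures_of_mem_infiniteVolumeLimitPoints_holds ρ hρ.1 hμ
  obtain ⟨φ, hφ, hprob, hconv⟩ := id hμ
  haveI := hprob
  set e₀ : Literature.MathematicalPhysics.QuantumLattice.ZdEdge d :=
    ((0 : Literature.Probability.LatticeModels.Site d), (0 : Fin d)) with he₀
  have h := PlaquetteFirstMoment.integral_sum_plaquetteObs_ge_sum ρ hρ hN hd hβ hG e₀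
  have hsum : ∫ U, ∑ p ∈ plaquettesTouching {e₀}, plaquetteObs ρ p.1 p.2.1.1 p.2.1.2 U ∂μ =
      (plaquettesTouching {e₀}).card * ∫ U, plaquetteObs ρ 0 0 1 U ∂μ := by
    rw [integral_finsetSum _ fun p _ => ?_]
    · rw [Finset.sum_congr rfl fun p _ =>
        PlaquettePositivity.integral_plaquetteObs_eq ρ hρ.1 hd hμ p.1 (ne_of_lt p.2.2),
        Finset.sum_const, nsmul_eq_mul]
    · exact (continuous_plaquetteObs ρ hρ.1 _ _ _).integrable_of_hasCompactSupport (HasCompactSupport.of_compactSpace _)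
  have hce : ((plaquettesTouching {e₀}).card : ℝ) = 2 * ((d : ℝ) - 1) := by
    rw [Balaban1983to89.Sufficient.card_plaquettesTouching_singleton e₀]
    have h1 : 1 ≤ d := by omega
    push_cast [Nat.cast_sub h1]
    ring
  rw [hsum, hce] at h
  have hdpos : (0 : ℝ) < 2 * ((d : ℝ) - 1) := by
    have : (2 : ℝ) ≤ d := by exact_mod_cast hd
    linarith
  rw [div_le_iff₀ hdpos]
  linarith

/-- ★ **`W_μ(1,1) ≥ u · e^{−D} · (1/(2(d−1))) ∑_{k=1}^{2(d−1)} e^{−kD}`** with `u = βV₀/N` and `D = 4(d−1)Nβ`, for every `G ≅ SU(N)`,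
`N ≥ 2`, `d ≥ 2`, `β ≥ 0` and every infinite-volume limit state (the master bound; its `k = 1` term is rb-p2 g3's
`PlaquettePositivity.rectExpectation_one_one_ge`). [folklore] -/
theorem rectExpectation_one_one_ge_sum (hρ : IsSpecialUnitaryModel ρ) (hN : 2 ≤ N) (hd : 2 ≤ d) {β : ℝ} (hβ : 0 ≤ β)
    {μ : Measure (LGConfig d G)} (hμ : μ ∈ infiniteVolumeLimitPoints ρ β) :
    β * PlaquetteLowerBound.charVariance ρ / N * Real.exp (-(4 * ((d : ℝ) - 1) * N * β)) *
        ((∑ k ∈ Finset.range (2 * (d - 1)), Real.exp (-(((k : ℝ) + 1) * (4 * ((d : ℝ) - 1) * N * β)))) /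
          (2 * ((d : ℝ) - 1))) ≤
      rectExpectation μ (fun g => normalisedCharacter N (ρ g)) 0 1 1 1 := by
  have h := integral_plaquetteObs_ge_sum ρ hρ hN hd hβ hμ
  have hN0 : (0 : ℝ) < N := by exact_mod_cast (show 0 < N by omega)
  have hW : rectExpectation μ (fun g => normalisedCharacter N (ρ g)) 0 1 1 1 = (N : ℝ)⁻¹ * ∫ U, plaquetteObs ρ 0 0 1 U ∂μ := by
    have hline : ∀ (U : LGConfig d G) (i : Fin d) (x : Literature.Probability.LatticeModels.Site d),
        walkHolonomy U (lineWalk i 1 x) = U (x, i) := fun U i x => by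
      rw [lineWalk, walkHolonomy_cons, walkHolonomy_copy, lineWalk, walkHolonomy_copy, walkHolonomy_nil, mul_one,
        dartHolonomy_add_single]
    have hhol : ∀ U : LGConfig d G, walkHolonomy U (rectWalk 0 0 1 1 1) = plaquetteHolonomyZd U 0 0 1 := fun U => by
      simp only [rectWalk, walkHolonomy_append, walkHolonomy_copy, walkHolonomy_reverse, hline, Nat.cast_one,
        plaquetteHolonomyZd, mul_assoc]
    unfold rectExpectation loopExpectation wilsonLoopObs
    simp only [normalisedCharacter, plaquetteObs, hhol]
    rw [integral_const_mul]
  rw [hW]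
  have e : β * PlaquetteLowerBound.charVariance ρ / N * Real.exp (-(4 * ((d : ℝ) - 1) * N * β)) *
      ((∑ k ∈ Finset.range (2 * (d - 1)), Real.exp (-(((k : ℝ) + 1) * (4 * ((d : ℝ) - 1) * N * β)))) /
        (2 * ((d : ℝ) - 1))) =
      (N : ℝ)⁻¹ * (β * Real.exp (-(4 * ((d : ℝ) - 1) * N * β)) * PlaquetteLowerBound.charVariance ρ *
        (∑ k ∈ Finset.range (2 * (d - 1)), Real.exp (-(((k : ℝ) + 1) * (4 * ((d : ℝ) - 1) * N * β)))) /
          (2 * ((d : ℝ) - 1))) := by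
    field_simp
  rw [e]
  exact mul_le_mul_of_nonneg_left h (by positivity)

/-- ★★ **THE PLAQUETTE OF EVERY LIMIT STATE CARRIES THE EXACT LEADING COEFFICIENT, up to `e^{−O(β)}`**:
`W_μ(1,1) ≥ (βV₀/N) · e^{−2(d−1)(2d+1)Nβ}` for every `G ≅ SU(N)`, `N ≥ 2`, `d ≥ 2`, `β ≥ 0`, every infinite-volume limit state
(`βV₀/N = β_W/4` for `SU(2)`, `β_W/(2N²)` for `N ≥ 3`, is the first term of the strong-coupling series of `W(1,1)`). [folklore] -/
theorem rectExpectation_one_one_ge_linear (hρ : IsSpecialUnitaryModel ρ) (hN : 2 ≤ N) (hd : 2 ≤ d) {β : ℝ} (hβ : 0 ≤ β)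
    {μ : Measure (LGConfig d G)} (hμ : μ ∈ infiniteVolumeLimitPoints ρ β) :
    β * PlaquetteLowerBound.charVariance ρ / N * Real.exp (-(2 * ((d : ℝ) - 1) * (2 * (d : ℝ) + 1) * N * β)) ≤
      rectExpectation μ (fun g => normalisedCharacter N (ρ g)) 0 1 1 1 := by
  refine le_trans ?_ (rectExpectation_one_one_ge_sum ρ hρ hN hd hβ hμ)
  set D : ℝ := 4 * ((d : ℝ) - 1) * N * β with hD
  have hN0 : (0 : ℝ) < N := by exact_mod_cast (show 0 < N by omega)
  have hdpos : (0 : ℝ) < 2 * ((d : ℝ) - 1) := by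
    have : (2 : ℝ) ≤ d := by exact_mod_cast hd
    linarith
  have hV := (PlaquetteLowerBound.charVariance_pos ρ hρ.1 (by omega)).le
  have hm : ((2 * (d - 1) : ℕ) : ℝ) = 2 * ((d : ℝ) - 1) := by
    have h1 : 1 ≤ d := by omega
    push_cast [Nat.cast_sub h1]; ring
  have havg := card_mul_exp_le_sum_exp (2 * (d - 1)) D
  rw [hm] at havg
  -- `e^{−D} · e^{−(2(d−1)+1)D/2} = e^{−2(d−1)(2d+1)Nβ}`
  have hexp : Real.exp (-(2 * ((d : ℝ) - 1) * (2 * (d : ℝ) + 1) * N * β)) =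
      Real.exp (-D) * Real.exp (-((2 * ((d : ℝ) - 1) + 1) / 2 * D)) := by
    rw [← Real.exp_add, hD]; ring_nf
  rw [hexp]
  have hkey : Real.exp (-((2 * ((d : ℝ) - 1) + 1) / 2 * D)) ≤
      (∑ k ∈ Finset.range (2 * (d - 1)), Real.exp (-(((k : ℝ) + 1) * D))) / (2 * ((d : ℝ) - 1)) := by
    rw [le_div_iff₀ hdpos]; linarith
  calc β * PlaquetteLowerBound.charVariance ρ / N * (Real.exp (-D) * Real.exp (-((2 * ((d : ℝ) - 1) + 1) / 2 * D)))
      = β * PlaquetteLowerBound.charVariance ρ / N * Real.exp (-D) * Real.exp (-((2 * ((d : ℝ) - 1) + 1) / 2 * D)) := by ring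
    _ ≤ β * PlaquetteLowerBound.charVariance ρ / N * Real.exp (-D) *
        ((∑ k ∈ Finset.range (2 * (d - 1)), Real.exp (-(((k : ℝ) + 1) * D))) / (2 * ((d : ℝ) - 1))) :=
        mul_le_mul_of_nonneg_left hkey (by positivity)

/-- **The ceiling without an additive constant, abstract form**: for every `G ≅ SU(N)`, `N ≥ 2`, `d ≥ 2`, every `β > 0` and every
infinite-volume limit state, `−log W_μ(1,1) ≤ log(N/(βV₀)) + 2(d−1)(2d+1)Nβ` (`log(N/(βV₀)) = log(1/u)`). [folklore] -/
theorem neg_log_plaquette_le_linear_of_model (hρ : IsSpecialUnitaryModel ρ) (hN : 2 ≤ N) (hd : 2 ≤ d) {β : ℝ} (hβ : 0 < β)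
    {μ : Measure (LGConfig d G)} (hμ : μ ∈ infiniteVolumeLimitPoints ρ β) :
    -Real.log (rectExpectation μ (fun g => normalisedCharacter N (ρ g)) 0 1 1 1) ≤
      Real.log (N / (β * PlaquetteLowerBound.charVariance ρ)) + 2 * ((d : ℝ) - 1) * (2 * (d : ℝ) + 1) * N * β := by
  have h := rectExpectation_one_one_ge_linear ρ hρ hN hd hβ.le hμ
  have hV := PlaquetteLowerBound.charVariance_pos ρ hρ.1 (by omega)
  have hN0 : (0 : ℝ) < N := by exact_mod_cast (show 0 < N by omega)
  have hpos : 0 < β * PlaquetteLowerBound.charVariance ρ / N * Real.exp (-(2 * ((d : ℝ) - 1) * (2 * (d : ℝ) + 1) * N * β)) := by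
    positivity
  have hlog := neg_le_neg (Real.log_le_log hpos h)
  have hval : -Real.log (β * PlaquetteLowerBound.charVariance ρ / N *
      Real.exp (-(2 * ((d : ℝ) - 1) * (2 * (d : ℝ) + 1) * N * β))) =
      Real.log (N / (β * PlaquetteLowerBound.charVariance ρ)) + 2 * ((d : ℝ) - 1) * (2 * (d : ℝ) + 1) * N * β := by
    rw [Real.log_mul (by positivity) (Real.exp_pos _).ne', Real.log_exp]
    have e2 : Real.log (β * PlaquetteLowerBound.charVariance ρ / N) = -Real.log (N / (β * PlaquetteLowerBound.charVariance ρ)) := by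
      rw [← Real.log_inv, inv_div]
    rw [e2]; ring
  linarith

/-- **THE STRING-TENSION CEILING WITHOUT AN ADDITIVE CONSTANT, abstract form**: for every `G ≅ SU(N)`, `N ≥ 2`, `d ≥ 2`, every
`β > 0` and every infinite-volume limit state, `σ(μ) ≤ log(N/(βV₀)) + 2(d−1)(2d+1)Nβ`. [folklore] -/
theorem stringTension_le_log_linear_of_model (hρ : IsSpecialUnitaryModel ρ) (hN : 2 ≤ N) (hd : 2 ≤ d) {β : ℝ} (hβ : 0 < β)
    {μ : Measure (LGConfig d G)} (hμ : μ ∈ infiniteVolumeLimitPoints ρ β) :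
    stringTension μ (fun g => normalisedCharacter N (ρ g)) ≤
      Real.log (N / (β * PlaquetteLowerBound.charVariance ρ)) + 2 * ((d : ℝ) - 1) * (2 * (d : ℝ) + 1) * N * β := by
  obtain ⟨-, -, hle, -⟩ := WilsonStringTension.stringTension_le ρ hρ hN hd hβ hμ
  exact hle.trans (neg_log_plaquette_le_linear_of_model ρ hρ hN hd hβ hμ)

end Model

end StringTensionExplicit

end Summit.Ventures.YMGap.RobustBall
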